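import Summits.AtomisticToContinuum.Crystallization.Theorems.ChargedEnergyGapStabilityReductionA
import HarnessLib

/-!
# «StabilityReduction» P-K STAB-61 typed and reduced (lens-3 g61) — part 2 of 3 (sequel of `…ChargedEnergyGapStabilityReductionA`)

Split for the 400-line cap by the landing lane (hand-2 g31); the module docstring of part 1 (`…ChargedEnergyGapStabilityReductionA`) describes the whole node.  Same namespace; all FQNs unchanged.
0 sorry; standard axioms.
-/

noncomputable section
open scoped Classical
open Literature.MathematicalPhysics.StatisticalMechanics
open Literature.Geometry.DiscreteGeometry
open Summit.AtomisticToContinuum.Crystallization.Theses.PricedLinkCensus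
open Summit.AtomisticToContinuum.Crystallization.Theorems.ChargedEnergyGapNegative

namespace Summit.AtomisticToContinuum.Crystallization.Theorems.ChargedEnergyGapChartDial

-- PRIVATE copies (landing lane): these helpers are `private` in `ChargedEnergyGapStressFreeFccB` (dedup gate), so each consumer module carries its own private copy.
/-- `sqrt2_sq` (docstring added by the landing lane; see the module docstring). [formal bookkeeping] -/
private theorem sqrt2_sq : Real.sqrt 2 ^ 2 = 2 := Real.sq_sqrt (by norm_num)

namespace Fcc

/-! ## §K4 The range-`2` Dirichlet term is a finite sum over an explicit neighbour set -/

section Dirichlet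

/-- The NEIGHBOUR SET of the origin in `b·D₃` within distance `2`: `{x ∈ [−4, 4]³ : x ≠ 0, Σ xₖ even, b²|x|² ≤ 4}` (for `b² ≥ 9/50` the box is no
restriction; numerically, at `b = a₀`, the `54` vectors with `|x|² ≤ 8`). -/
def nbhd (b : ℝ) : Finset (Fin 3 → ℤ) :=
  (Fintype.piFinset fun _ : Fin 3 => Finset.Icc (-4 : ℤ) 4).filter fun x => x ≠ 0 ∧ Even (∑ k, x k) ∧ b ^ 2 * nsq x ≤ 4

/-- `vec_inj` (docstring added by the landing lane; see the module docstring). [formal bookkeeping] -/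
theorem vec_inj {b : ℝ} (hb : 0 < b) : Function.Injective (vec b) := fun x y h => by
  funext k
  have := congrArg (fun z : E3 => z k) h
  simpa [vec_apply, hb.ne'] using this

/-- `sq_le_nsq` (docstring added by the landing lane; see the module docstring). [formal bookkeeping] -/
theorem sq_le_nsq (x : Fin 3 → ℤ) (k : Fin 3) : ((x k : ℝ)) ^ 2 ≤ nsq x := by
  unfold nsq
  exact Finset.single_le_sum (f := fun k => ((x k : ℝ)) ^ 2) (fun _ _ => sq_nonneg _) (Finset.mem_univ k)

/-- `dirichlet_set_eq` (docstring added by the landing lane; see the module docstring). [formal bookkeeping] -/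
theorem dirichlet_set_eq {b : ℝ} (hb : 0 < b) (hb2 : 9 / 50 ≤ b ^ 2) :
    {z : E3 | z ∈ (fccRef b hb).points ∧ z ≠ 0 ∧ dist 0 z ≤ 2} = ((nbhd b).image (vec b) : Set E3) := by
  ext z
  simp only [Set.mem_setOf_eq, Finset.coe_image, Set.mem_image, Finset.mem_coe, nbhd, Finset.mem_filter,
    Fintype.mem_piFinset, Finset.mem_Icc]
  constructor
  · rintro ⟨hz, hz0, hd⟩
    obtain ⟨x, hx, rfl⟩ := (mem_points_iff_even b hb z).1 hz
    have hx0 : x ≠ 0 := fun h => hz0 (by rw [h, vec_zero])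
    rw [dist_zero_vec b hb] at hd
    have hsq : b ^ 2 * nsq x ≤ 4 := by
      have h0 : 0 ≤ b * Real.sqrt (nsq x) := by positivity
      have := mul_self_le_mul_self h0 hd
      rw [← sq, mul_pow, Real.sq_sqrt (nsq_nonneg x)] at this
      linarith
    refine ⟨x, ⟨fun k => ?_, hx0, hx, hsq⟩, rfl⟩
    have hk : ((x k : ℝ)) ^ 2 < 25 := by
      have h1 := sq_le_nsq x k
      nlinarith
    have hk' : ((x k : ℤ)) ^ 2 < 25 := by exact_mod_cast hk
    constructor <;> nlinarith
  · rintro ⟨x, ⟨-, hx0, hx, hsq⟩, rfl⟩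
    refine ⟨vec_mem_points hb hx, fun h => hx0 ((vec_eq_zero_iff b hb x).1 h), ?_⟩
    rw [dist_zero_vec b hb]
    have h0 : 0 ≤ b * Real.sqrt (nsq x) := by positivity
    nlinarith [Real.sq_sqrt (nsq_nonneg x), Real.sqrt_nonneg (nsq x)]

/-- ★ THE DIRICHLET SITE TERM at the origin of `b·D₃` is the FINITE sum over the neighbour set. -/
theorem dirichletSite_eq (β : E3 → E3 → E3) {b : ℝ} (hb : 0 < b) (hb2 : 9 / 50 ≤ b ^ 2) :
    dirichletSite β (fccRef b hb) 0 = ∑ x ∈ nbhd b, ‖β 0 (vec b x)‖ ^ 2 := by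
  unfold dirichletSite
  have h1 : (∑' z : {z : E3 // z ∈ (fccRef b hb).points ∧ z ≠ 0 ∧ dist 0 z ≤ 2}, ‖β 0 (z : E3)‖ ^ 2) =
      ∑' z : ((nbhd b).image (vec b) : Set E3), ‖β 0 (z : E3)‖ ^ 2 :=
    tsum_congr_set_coe (fun z : E3 => ‖β 0 z‖ ^ 2) (dirichlet_set_eq hb hb2)
  rw [h1, Finset.tsum_subtype' ((nbhd b).image (vec b)) (fun z : E3 => ‖β 0 z‖ ^ 2),
    Finset.sum_image fun x _ y _ h => vec_inj hb h]

end Dirichlet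

/-! ## §K5 THE REDUCTION: stability modulo rotations ⟸ zero stress + one explicit lattice-sum inequality -/

section Reduction

/-- ★ THE EXPLICIT STABILITY INEQUALITY of the Bravais fcc reference `b·D₃` with margin `μ₀` (finite-dimensional: `M` ranges over `3 × 3`
real matrices; only its symmetric part `E = (M + Mᵀ)/2` enters): `μ₀ · Σ_{x ∈ nbhd b} ‖E (b·x)‖² ≤ ¼ · Σ_{n ∈ D₃∖0} (14|b·n|⁻¹⁶ − 8|b·n|⁻¹⁰)((b·n)ᵀM(b·n))²`
— the gauged affine (elastic) stability of the Lennard-Jones fcc lattice in the Dirichlet currency.  Census STAB-61 computes it; numerically at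
`b = a₀`: softest direction the deviatoric diagonal strain `E = diag(1, −1, 0)`, ratio `≈ 0.038 > 1/100`. -/
def StabIneq (μ₀ b : ℝ) : Prop :=
  ∀ M : Fin 3 → Fin 3 → ℝ,
    μ₀ * ∑ x ∈ nbhd b, ∑ i, (∑ j, (M i j + M j i) / 2 * ((x j : ℝ) * b)) ^ 2 ≤ (1 / 4) * Qsum M b

/-- ★★★ **THE REDUCTION.**  On the Bravais fcc reference `b·D₃` (`b² ≥ 9/50`) with vanishing virial, `HarmStableModRot μ₀` FOLLOWS from the
explicit inequality `StabIneq μ₀ b`: a global cocycle is a linear map `M` (§K1), its skew part is gauged away EXACTLY by a rotation cocycle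
(§K2), the gauged Dirichlet term is the finite neighbour sum of `‖E(b·x)‖²` (§K4) and the quadratic site term is `¼` of the stiffness sum (§K3). -/
theorem harmStableModRot_of_stabIneq {μ₀ b : ℝ} (hb : 0 < b) (hb2 : 9 / 50 ≤ b ^ 2) (hS : ∀ j k, S b j k = 0)
    (hI : StabIneq μ₀ b) : HarmStableModRot μ₀ (fccRef b hb) := by
  intro β hβ
  obtain ⟨M, hM⟩ := exists_matrix hb hβ
  obtain ⟨r₀, v, h01, h02, h12⟩ := exists_rot_gauge ((M 0 1 - M 1 0) / 2) ((M 0 2 - M 2 0) / 2) ((M 1 2 - M 2 1) / 2)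
  refine ⟨r₀, v, ?_⟩
  rw [fccRef_motif, Finset.sum_singleton, Finset.sum_singleton, dirichletSite_eq _ hb hb2, quadSite_eq hb hM hS]
  have hW : ∀ i j : Fin 3, v i * r₀ j - r₀ i * v j = (M i j - M j i) / 2 := by
    intro i j
    fin_cases i <;> fin_cases j <;> simp <;> linarith
  have hE : ∀ x ∈ nbhd b, ‖gaugedField β r₀ v 0 (vec b x)‖ ^ 2 = ∑ i, (∑ j, (M i j + M j i) / 2 * ((x j : ℝ) * b)) ^ 2 := by
    intro x hx
    have hxe : Even (∑ k, x k) := ((Finset.mem_filter.1 hx).2).2.1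
    rw [EuclideanSpace.real_norm_sq_eq]
    refine Finset.sum_congr rfl fun i _ => ?_
    congr 1
    simp only [gaugedField, PiLp.sub_apply, hM x hxe i, rotField_zero_apply, vec_apply, ← Finset.sum_sub_distrib]
    exact Finset.sum_congr rfl fun j _ => by rw [hW i j]; ring
  rw [Finset.sum_congr rfl hE]
  exact hI M

end Reduction

/-! ## §K6 At the stress-free parameter `a₀` -/

section AtA0

/-- `a₀² ≥ 9/50`, from P-J's certified window `3/5 ≤ a₀√2`. -/
theorem a0_sq_ge : 9 / 50 ≤ a0 ^ 2 := by
  have h := three_fifths_le_a0_sqrt2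
  have h2 : (a0 * Real.sqrt 2) ^ 2 = 2 * a0 ^ 2 := by rw [mul_pow, sqrt2_sq]; ring
  have h3 : (3 / 5 : ℝ) ^ 2 ≤ (a0 * Real.sqrt 2) ^ 2 := pow_le_pow_left₀ (by norm_num) h 2
  rw [h2] at h3
  linarith

/-- ★★★ STAB-61 TYPED: on the stress-free fcc reference, stability modulo rotations with margin `μ₀` follows from the explicit inequality
`StabIneq μ₀ a₀` alone. -/
theorem harmStableModRot_fcc_a0 {μ₀ : ℝ} (hI : StabIneq μ₀ a0) : HarmStableModRot μ₀ (fccRef a0 a0_pos) :=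
  harmStableModRot_of_stabIneq a0_pos a0_sq_ge S_a0_eq_zero hI

/-- ★★★ (K-v) MODULO ONE INEQUALITY: the COMPLETE hypothesis block of the repaired transfer piece (H𝄪ʳ) at the record dials
`s = 3/5, lam = 1/3, ℓ = 3, μ₀ = 1/100` is satisfiable as soon as `StabIneq (1/100) a₀` holds (census STAB-61; floating point: margin `3.8×`). -/
theorem exists_admissible_harmStableModRot_of (hI : StabIneq (1 / 100) a0) : ∃ P : PeriodicConfiguration 3,
    IsSeparatedRef (3 / 5) P ∧ IsLabelledRef (1 / 3) 3 P ∧ IsForceFree P ∧ IsStressFree P ∧ HarmStableModRot (1 / 100) P :=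
  ⟨fccRef a0 a0_pos, fcc_witness.1, fcc_witness.2.1, fcc_witness.2.2.1, fcc_witness.2.2.2, harmStableModRot_fcc_a0 hI⟩

end AtA0

/-! ## §K6 Cubic isotropy of the neighbour set and the CONVERSE -/

section Isotropy

variable {b : ℝ}

/-- Sign flip of one coordinate, as a permutation of `ℤ³`. -/
def negPerm (s : Fin 3) : Equiv.Perm (Fin 3 → ℤ) :=
  Function.Involutive.toPerm (negCoord s) (negCoord_negCoord s)

/-- Swap of the coordinates `0` and `s`, as a permutation of `ℤ³`. -/
def swapPerm (s : Fin 3) : Equiv.Perm (Fin 3 → ℤ) :=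
  Function.Involutive.toPerm (swapCoord s) (swapCoord_swapCoord s)

/-- `negPerm_apply` (docstring added by the landing lane; see the module docstring). [formal bookkeeping] -/
@[simp] theorem negPerm_apply (s : Fin 3) (x : Fin 3 → ℤ) : negPerm s x = negCoord s x := rfl
/-- `swapPerm_apply` (docstring added by the landing lane; see the module docstring). [formal bookkeeping] -/
@[simp] theorem swapPerm_apply (s : Fin 3) (x : Fin 3 → ℤ) : swapPerm s x = swapCoord s x := rfl

/-- `even_sub_two_mul_iff` (docstring added by the landing lane; see the module docstring). [formal bookkeeping] -/
theorem even_sub_two_mul_iff (a c : ℤ) : Even (a - 2 * c) ↔ Even a := by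
  constructor
  · intro h; have := h.add (even_two_mul c); simpa using this
  · intro h; exact h.sub (even_two_mul c)

/-- `mem_nbhd_iff` (docstring added by the landing lane; see the module docstring). [formal bookkeeping] -/
theorem mem_nbhd_iff (b : ℝ) (x : Fin 3 → ℤ) :
    x ∈ nbhd b ↔ (∀ k, -4 ≤ x k ∧ x k ≤ 4) ∧ x ≠ 0 ∧ Even (∑ k, x k) ∧ b ^ 2 * nsq x ≤ 4 := by
  simp only [nbhd, Finset.mem_filter, Fintype.mem_piFinset, Finset.mem_Icc]

/-- The neighbour set is invariant under sign flips … -/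
theorem mem_nbhd_negCoord (b : ℝ) (s : Fin 3) (x : Fin 3 → ℤ) : x ∈ nbhd b ↔ negCoord s x ∈ nbhd b := by
  suffices h : ∀ x : Fin 3 → ℤ, x ∈ nbhd b → negCoord s x ∈ nbhd b from
    ⟨h x, fun hx => by simpa [negCoord_negCoord] using h _ hx⟩
  intro x hx
  rw [mem_nbhd_iff] at hx ⊢
  obtain ⟨hbox, hx0, hev, hle⟩ := hx
  refine ⟨fun k => ?_, negCoord_ne_zero s hx0, ?_, by rwa [nsq_negCoord]⟩
  · have := hbox k
    by_cases hk : k = s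
    · subst hk; simp only [negCoord, if_true]; omega
    · simp only [negCoord, if_neg hk]; omega
  · rw [sum_negCoord, even_sub_two_mul_iff]; exact hev

/-- … and under coordinate swaps. -/
theorem mem_nbhd_swapCoord (b : ℝ) (s : Fin 3) (x : Fin 3 → ℤ) : x ∈ nbhd b ↔ swapCoord s x ∈ nbhd b := by
  suffices h : ∀ x : Fin 3 → ℤ, x ∈ nbhd b → swapCoord s x ∈ nbhd b from
    ⟨h x, fun hx => by simpa [swapCoord_swapCoord] using h _ hx⟩
  intro x hx
  rw [mem_nbhd_iff] at hx ⊢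
  obtain ⟨hbox, hx0, hev, hle⟩ := hx
  exact ⟨fun k => hbox _, swapCoord_ne_zero s hx0, by rwa [sum_swapCoord], by rwa [nsq_swapCoord]⟩

/-- Mixed second moments of the neighbour set VANISH … -/
theorem sum_nbhd_mul_eq_zero (b : ℝ) {j k : Fin 3} (hjk : j ≠ k) : ∑ x ∈ nbhd b, ((x j : ℝ)) * x k = 0 := by
  have h : ∑ x ∈ nbhd b, ((x j : ℝ)) * x k = ∑ x ∈ nbhd b, -(((x j : ℝ)) * x k) := by
    refine Finset.sum_equiv (negPerm j) (fun x => ?_) (fun x _ => ?_)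
    · exact mem_nbhd_negCoord b j x
    · simp only [negPerm_apply, negCoord, if_true, if_neg hjk.symm, Int.cast_neg]
      ring
  rw [Finset.sum_neg_distrib] at h
  linarith

/-- … and the pure ones AGREE (cubic isotropy). -/
theorem sum_nbhd_sq_eq (b : ℝ) (j : Fin 3) : ∑ x ∈ nbhd b, ((x j : ℝ)) ^ 2 = ∑ x ∈ nbhd b, ((x 0 : ℝ)) ^ 2 := by
  refine Finset.sum_equiv (swapPerm j) (fun x => mem_nbhd_swapCoord b j x) (fun x _ => ?_)
  simp only [swapPerm_apply, swapCoord, Equiv.swap_apply_left]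

/-- The SECOND MOMENT `N₂(b) = Σ_{x ∈ nbhd b} (b·x₀)²` (numerically `96·a₀² ≈ 45.28` at `b = a₀`). -/
def N2 (b : ℝ) : ℝ := ∑ x ∈ nbhd b, (((x 0 : ℝ)) * b) ^ 2

/-- `N2_nonneg` (docstring added by the landing lane; see the module docstring). [formal bookkeeping] -/
theorem N2_nonneg (b : ℝ) : 0 ≤ N2 b := Finset.sum_nonneg fun _ _ => sq_nonneg _

/-- ★ ISOTROPY: `Σ_{x ∈ nbhd b} ⟨a, b·x⟩² = N₂(b)·|a|²` for every covector `a`. -/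
theorem sum_nbhd_quad (b : ℝ) (a : Fin 3 → ℝ) :
    ∑ x ∈ nbhd b, (∑ j, a j * (((x j : ℝ)) * b)) ^ 2 = N2 b * ∑ j, a j ^ 2 := by
  have hmom : ∀ j k : Fin 3, ∑ x ∈ nbhd b, (((x j : ℝ)) * b) * (((x k : ℝ)) * b) = if j = k then N2 b else 0 := by
    intro j k
    split_ifs with hjk
    · subst hjk
      calc ∑ x ∈ nbhd b, ((x j : ℝ)) * b * (((x j : ℝ)) * b) = b ^ 2 * ∑ x ∈ nbhd b, ((x j : ℝ)) ^ 2 := by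
            rw [Finset.mul_sum]; exact Finset.sum_congr rfl fun x _ => by ring
        _ = b ^ 2 * ∑ x ∈ nbhd b, ((x 0 : ℝ)) ^ 2 := by rw [sum_nbhd_sq_eq]
        _ = N2 b := by unfold N2; rw [Finset.mul_sum]; exact Finset.sum_congr rfl fun x _ => by ring
    · have h0 := sum_nbhd_mul_eq_zero b hjk
      calc ∑ x ∈ nbhd b, ((x j : ℝ)) * b * (((x k : ℝ)) * b) = b ^ 2 * ∑ x ∈ nbhd b, ((x j : ℝ)) * x k := by
            rw [Finset.mul_sum]; exact Finset.sum_congr rfl fun x _ => by ring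
        _ = 0 := by rw [h0, mul_zero]
  calc ∑ x ∈ nbhd b, (∑ j, a j * (((x j : ℝ)) * b)) ^ 2
      = ∑ x ∈ nbhd b, ∑ j, ∑ k, a j * a k * ((((x j : ℝ)) * b) * (((x k : ℝ)) * b)) := by
        refine Finset.sum_congr rfl fun x _ => ?_
        rw [sq, Finset.sum_mul_sum]
        exact Finset.sum_congr rfl fun j _ => Finset.sum_congr rfl fun k _ => by ring
    _ = ∑ j, ∑ k, a j * a k * ∑ x ∈ nbhd b, (((x j : ℝ)) * b) * (((x k : ℝ)) * b) := by
        rw [Finset.sum_comm]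
        refine Finset.sum_congr rfl fun j _ => ?_
        rw [Finset.sum_comm]
        refine Finset.sum_congr rfl fun k _ => ?_
        rw [Finset.mul_sum]
    _ = N2 b * ∑ j, a j ^ 2 := by
        simp_rw [hmom]
        simp only [mul_ite, mul_zero, Finset.sum_ite_eq, Finset.mem_univ, if_true]
        rw [Finset.mul_sum]
        exact Finset.sum_congr rfl fun j _ => by ring

/-- ★ THE GAUGED DIRICHLET FORM of a linear field is `N₂(b)·‖M − W‖²_F`. -/
theorem sum_nbhd_field (b : ℝ) (A : Fin 3 → Fin 3 → ℝ) :
    ∑ x ∈ nbhd b, ∑ i, (∑ j, A i j * (((x j : ℝ)) * b)) ^ 2 = N2 b * ∑ i, ∑ j, A i j ^ 2 := by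
  rw [Finset.sum_comm, Finset.mul_sum]
  exact Finset.sum_congr rfl fun i _ => sum_nbhd_quad b (A i)

end Isotropy

section Converse

variable {μ₀ b : ℝ}

/-- The LINEAR COCYCLE of a matrix `M`: `β(y, z) = M(z − y)`. -/
def linCocycle (M : Fin 3 → Fin 3 → ℝ) : E3 → E3 → E3 :=
  fun y z => WithLp.toLp 2 fun i => ∑ j, M i j * (z - y) j

/-- `linCocycle_apply` (docstring added by the landing lane; see the module docstring). [formal bookkeeping] -/
@[simp] theorem linCocycle_apply (M : Fin 3 → Fin 3 → ℝ) (y z : E3) (i : Fin 3) :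
    linCocycle M y z i = ∑ j, M i j * (z - y) j := rfl

/-- `isGlobalCocycle_linCocycle` (docstring added by the landing lane; see the module docstring). [formal bookkeeping] -/
theorem isGlobalCocycle_linCocycle (P : PeriodicConfiguration 3) (M : Fin 3 → Fin 3 → ℝ) : IsGlobalCocycle P (linCocycle M) := by
  refine ⟨fun y _ z _ => ?_, fun g _ y z => ?_, fun y _ z _ x _ => ?_⟩
  · ext i
    simp only [linCocycle_apply, PiLp.neg_apply, PiLp.sub_apply, ← Finset.sum_neg_distrib]
    exact Finset.sum_congr rfl fun j _ => by ring
  · ext i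
    simp only [linCocycle_apply, PiLp.sub_apply, PiLp.add_apply]
    exact Finset.sum_congr rfl fun j _ => by ring
  · ext i
    simp only [linCocycle_apply, PiLp.add_apply, PiLp.sub_apply, ← Finset.sum_add_distrib]
    exact Finset.sum_congr rfl fun j _ => by ring

/-- ★★ THE CONVERSE: stability modulo rotations with margin `μ₀ ≥ 0` IMPLIES the explicit inequality — `StabIneq` is EXACTLY the content of
`HarmStableModRot` on the stress-free Bravais fcc reference (test the linear cocycle of `M`; any admissible gauge `W` only ADDS `N₂·‖skew(M) − W‖²`
to the Dirichlet side, by isotropy and `⟪sym, skew⟫ = 0`). -/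
theorem stabIneq_of_harmStableModRot (hμ : 0 ≤ μ₀) (hb : 0 < b) (hb2 : 9 / 50 ≤ b ^ 2) (hS : ∀ j k, S b j k = 0)
    (h : HarmStableModRot μ₀ (fccRef b hb)) : StabIneq μ₀ b := by
  intro M
  have hM : ∀ x : Fin 3 → ℤ, Even (∑ k, x k) → ∀ i, linCocycle M 0 (vec b x) i = ∑ j, M i j * ((x j : ℝ) * b) :=
    fun x _ i => by simp only [linCocycle_apply, sub_zero, vec_apply]
  obtain ⟨r₀, v, hle⟩ := h (linCocycle M) (isGlobalCocycle_linCocycle _ M)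
  rw [fccRef_motif, Finset.sum_singleton, Finset.sum_singleton, dirichletSite_eq _ hb hb2, quadSite_eq hb hM hS] at hle
  set W : Fin 3 → Fin 3 → ℝ := fun i j => v i * r₀ j - r₀ i * v j with hW
  have hG : ∀ x ∈ nbhd b, ‖gaugedField (linCocycle M) r₀ v 0 (vec b x)‖ ^ 2 = ∑ i, (∑ j, (M i j - W i j) * (((x j : ℝ)) * b)) ^ 2 := by
    intro x _
    rw [EuclideanSpace.real_norm_sq_eq]
    refine Finset.sum_congr rfl fun i _ => ?_
    congr 1
    simp only [gaugedField, PiLp.sub_apply, linCocycle_apply, sub_zero, rotField_zero_apply, vec_apply, ← Finset.sum_sub_distrib, hW]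
    exact Finset.sum_congr rfl fun j _ => by ring
  rw [Finset.sum_congr rfl hG, sum_nbhd_field] at hle
  rw [sum_nbhd_field]
  have hkey : ∑ i, ∑ j, ((M i j + M j i) / 2) ^ 2 ≤ ∑ i, ∑ j, (M i j - W i j) ^ 2 := by
    simp only [Fin.sum_univ_three, hW]
    nlinarith [sq_nonneg ((M 0 1 - M 1 0) / 2 - (v 0 * r₀ 1 - r₀ 0 * v 1)), sq_nonneg ((M 0 2 - M 2 0) / 2 - (v 0 * r₀ 2 - r₀ 0 * v 2)),
      sq_nonneg ((M 1 2 - M 2 1) / 2 - (v 1 * r₀ 2 - r₀ 1 * v 2)), sq_nonneg (v 0 * r₀ 0 - r₀ 0 * v 0)]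
  calc μ₀ * (N2 b * ∑ i, ∑ j, ((M i j + M j i) / 2) ^ 2) ≤ μ₀ * (N2 b * ∑ i, ∑ j, (M i j - W i j) ^ 2) :=
        mul_le_mul_of_nonneg_left (mul_le_mul_of_nonneg_left hkey (N2_nonneg b)) hμ
    _ ≤ (1 / 4) * Qsum M b := hle

/-- ★★★ THE EQUIVALENCE on the stress-free Bravais fcc reference (`μ₀ ≥ 0`, `b² ≥ 9/50`, zero virial). -/
theorem harmStableModRot_iff_stabIneq (hμ : 0 ≤ μ₀) (hb : 0 < b) (hb2 : 9 / 50 ≤ b ^ 2) (hS : ∀ j k, S b j k = 0) :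
    HarmStableModRot μ₀ (fccRef b hb) ↔ StabIneq μ₀ b :=
  ⟨stabIneq_of_harmStableModRot hμ hb hb2 hS, harmStableModRot_of_stabIneq hb hb2 hS⟩

end Converse

end Fcc

end Summit.AtomisticToContinuum.Crystallization.Theorems.ChargedEnergyGapChartDial

end
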